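import Summits.QuantumFields.BalabanUV.T4Continuum.Support.ChainEndFix
import Summits.QuantumFields.BalabanUV.T4Continuum.Support.GaugeFieldPerturbation
import HarnessLib

/-!
# T⁴ programme, node NE3 — kinematic refinement lemma, row R0 (glue), part 2a: THE EXACT CHAIN-END FIX READ IN `M_N(ℂ)`
# (translation covariance and bond-wise size of `modify`; the owner's leaf R2 for periodic unitary matrix fields)

NE3 formalisation swarm `b2b-balaban-t4-ne3-formalise-*`, LEAF PROVER 09 (unit `b2b-balaban-t4-ne3-formalise-leaf-09`),
crew register `t4/formal/NE3/LEAVES.md` row **R0**; owner skeleton `t4/b2b-balaban-t4-ne3-p1/SKELETON-NE3-P1.md` v1.1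
§3 rows R0/R2.

INPUT = the owner's **`ChainEndFix.rescale_bavg_modify_corrField_eq`** (leaf R2 of the kinematic lemma, KERNEL, abstract
C⋆-algebra): a unitary fine field `W` with `|W(∂p) − 1| ≤ a` whose block average (42) misses a unitary coarse field `U`
by `≤ δ` at every coarse bond is corrected on the chain-end bonds by unitaries within `2δ/g` of `1` (`g = gap d L = L^{1−d}`)
so that `rescale L (bavg L (modify L W c)) = U` EXACTLY; `corrField_shift`: periodic data give a periodic correction.
THIS FILE ([folklore] bookkeeping): §1 `isChainEnd_add_smul_iff`, `chainIndex_add_smul`, `modify_add_smul` ⟹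
**`isPeriodicCfg_modify`** (`modify L W c` is `(L·P)`-periodic when `W` is `(L·P)`-periodic and `c` is `P`-periodic —
`T4AveragingDeficitWallBoundary.IsPeriodicCfg` BY NAME) and `norm_modify_sub_le` (bond-wise `‖modify L W c − W‖ ≤ ρ` from
`‖c − 1‖ ≤ ρ`, via part 1 `GaugeFieldPerturbation.norm_mul_sub_self_le`); §2 **`exists_chainEndFix`**: the owner's theorem
+ `corrField_shift` instantiated in `M_N(ℂ)` with the operator norm (19) (`letI : CStarAlgebra (Matrix n n ℂ) := {}` inside
the proof; no instance is declared): ∃ a unitary `(L·P)`-periodic `W′` within `2δ/g` of `W` at every fine bond with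
`rescale L (bavg L W′) = U`.  Part 2b (`SmoothRefineAssembly`, the composition into `MinimalActionRefine.SmoothRefine`)
imports this file and `MinimalActionRefine` (p209344).

HONEST FRAMING.  No printed sentence is a hypothesis; `modify`/`corrField`/`gap`/`IsChainEnd`/`chainIndex`/`IsUnitaryCfg`/
`IsPeriodicCfg`/`SmallField`/`bavg`/`rescale` imported BY NAME, nothing restated; no `def … : Prop` fact; no `sorry`;
axioms ⊆ {propext, Classical.choice, Quot.sound}.  NE3 NOT proved; spine 0/9; the cell's conditionals (`BetaPertH`, (B),
G-an2-4) occur nowhere here; finite T⁴ rung (B)+1 — NOT infinite volume, NOT a mass gap, NOT the Clay problem.  HONEST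
DEPENDENCY (cell page 1): continuum YM on T⁴ ⇐ BetaPertH ∧ nine spine estimates (0/9 proved); BetaPertH ⇐ (D1) ∧ (D4) ∧
CAP+tail; G-an2-4 gates asym, D1 and NE2/3/4.  PLACEMENT (human rule 2026-08-19): cell work under
`Summits/QuantumFields/BalabanUV/`; imports tree modules only (`Support.ChainEndFix`, `Support.GaugeFieldPerturbation`);
moves nothing.
-/

set_option autoImplicit false

open scoped BigOperators Matrix Matrix.Norms.L2Operator
open NormedSpace

namespace Summit.QuantumFields.BalabanUV.T4Continuum.ChainEndFixMatrix

open Literature.MathematicalPhysics.QuantumFieldTheory.Balaban1983to89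
open B7Prop1Explicit B7Prop2Explicit MatrixLog UnitaryModel
open T4AveragingDeficitWall hiding Site Plane Plaq Bond
open T4AveragingDeficitWallBoundary (IsPeriodicCfg)
open AveragingDeficitTransport (mem_U1_of_unitary)
open ChainEndWords (IsChainEnd chainIndex modify_mem)
open ChainEndFix (gap gap_pos corrField corrField_mem corrField_shift rescale_bavg_modify_corrField_eq)
open GaugeFieldPerturbation (norm_mul_sub_self_le)

noncomputable section

variable {d : ℕ}

/-! ## §1 The chain-end modification: translation covariance and bond-wise size -/

section Modify

variable {G : Type*} [Group G]

/-- A shift by a multiple of `L` in one direction does not change which fine bonds are chain ends. [folklore] -/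
theorem isChainEnd_add_smul_iff (L : ℕ) {P : ℤ} (hP : (L : ℤ) ∣ P) (y : Site d) (κ μ : Fin d) :
    IsChainEnd L (y + P • e κ) μ ↔ IsChainEnd L y μ := by
  unfold IsChainEnd
  refine forall_congr' fun ν => ?_
  simp only [Pi.add_apply, Pi.smul_apply, smul_eq_mul]
  rw [show y ν + P * e κ ν + e μ ν = P * e κ ν + (y ν + e μ ν) by ring]
  exact dvd_add_right (hP.mul_right _)

/-- … and shifts the coarse bond of a chain end accordingly: `chainIndex (y + LP e_κ) = chainIndex y + P e_κ`. [folklore] -/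
theorem chainIndex_add_smul (L : ℕ) (hL : 1 ≤ L) (P : ℤ) (y : Site d) (κ μ : Fin d) :
    chainIndex L (y + ((L : ℤ) * P) • e κ) μ = chainIndex L y μ + P • e κ := by
  have hL0 : (L : ℤ) ≠ 0 := by exact_mod_cast (by omega : L ≠ 0)
  ext ν
  simp only [chainIndex, Pi.add_apply, Pi.smul_apply, smul_eq_mul]
  rw [show y ν + (L : ℤ) * P * e κ ν + e μ ν = (y ν + e μ ν) + (P * e κ ν) * (L : ℤ) by ring,
    Int.add_mul_ediv_right _ _ hL0]
  ring

/-- **TRANSLATION COVARIANCE OF `modify`**: if `W` is `LP e_κ`-invariant and `c` is `P e_κ`-invariant then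
`modify L W c` is `LP e_κ`-invariant. [folklore] -/
theorem modify_add_smul (L : ℕ) (hL : 1 ≤ L) {W c : Site d → Fin d → G} {P : ℤ}
    (hW : ∀ (x : Site d) (κ μ : Fin d), W (x + ((L : ℤ) * P) • e κ) μ = W x μ)
    (hc : ∀ (z : Site d) (κ μ : Fin d), c (z + P • e κ) μ = c z μ) (y : Site d) (κ μ : Fin d) :
    ChainEndWords.modify L W c (y + ((L : ℤ) * P) • e κ) μ = ChainEndWords.modify L W c y μ := by
  have hiff := isChainEnd_add_smul_iff L (P := (L : ℤ) * P) (dvd_mul_right _ _) y κ μ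
  by_cases h : IsChainEnd L y μ
  · rw [ChainEndWords.modify, ChainEndWords.modify, if_pos (hiff.mpr h), if_pos h, chainIndex_add_smul L hL P y κ μ, hW, hc]
  · rw [ChainEndWords.modify, ChainEndWords.modify, if_neg (fun h' => h (hiff.mp h')), if_neg h, hW]

end Modify

section Matrices

variable {n : Type*} [Fintype n] [DecidableEq n]

/-- `modify` of an `(L·P)`-periodic fine field by a `P`-periodic coarse field is `(L·P)`-periodic
(`T4AveragingDeficitWallBoundary.IsPeriodicCfg` by name). [folklore] -/
theorem isPeriodicCfg_modify (L : ℕ) (hL : 1 ≤ L) {W c : Site d → Fin d → (Matrix n n ℂ)ˣ} {P : ℕ}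
    (hW : IsPeriodicCfg W ((L * P : ℕ) : ℤ)) (hc : IsPeriodicCfg c (P : ℤ)) :
    IsPeriodicCfg (ChainEndWords.modify L W c) ((L * P : ℕ) : ℤ) := by
  intro y κ μ
  have hW' : ∀ (x : Site d) (κ μ : Fin d), W (x + ((L : ℤ) * (P : ℤ)) • e κ) μ = W x μ := fun x κ μ => by
    have := hW x κ μ; push_cast at this; exact this
  have := modify_add_smul L hL hW' hc y κ μ
  push_cast
  exact this

/-- **BOND-WISE SIZE OF THE MODIFICATION**: for unitary `W` and a correction field within `ρ` of `1`,
`‖ChainEndWords.modify L W c (y, μ) − W(y, μ)‖ ≤ ρ` at every fine bond (it is `0` off the chain ends). [folklore] -/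
theorem norm_modify_sub_le [Nonempty n] (L : ℕ) {W c : Site d → Fin d → (Matrix n n ℂ)ˣ} (hW : IsUnitaryCfg W)
    {ρ : ℝ} (hρ : 0 ≤ ρ) (hc : ∀ (z : Site d) (μ : Fin d), ‖((c z μ : (Matrix n n ℂ)ˣ) : Matrix n n ℂ) - 1‖ ≤ ρ)
    (y : Site d) (μ : Fin d) :
    ‖((ChainEndWords.modify L W c y μ : (Matrix n n ℂ)ˣ) : Matrix n n ℂ) - ((W y μ : (Matrix n n ℂ)ˣ) : Matrix n n ℂ)‖ ≤ ρ := by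
  unfold ChainEndWords.modify
  split_ifs with h
  · exact (norm_mul_sub_self_le (u := fun y μ => c (chainIndex L y μ) μ) hW y μ).trans (hc _ _)
  · simpa using hρ

/-! ## §2 Leaf R2 at the matrix level: the exact chain-end fix of a periodic unitary fine field -/

/-- **THE EXACT CHAIN-END FIX, MATRIX READING** (owner's `ChainEndFix.rescale_bavg_modify_corrField_eq` +
`corrField_shift`, instantiated in `M_N(ℂ)` with the operator norm (19)): a unitary `(L·P)`-periodic fine field `W` in
the small-field class of radius `a` whose block average misses the unitary `P`-periodic coarse field `U` by `≤ δ` at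
every coarse bond has a unitary `(L·P)`-periodic modification `W′`, within `2δ/g` of `W` at every fine bond, with
`rescale L (bavg L W′) = U` EXACTLY — under the owner's two smallness conditions. [folklore] -/
theorem exists_chainEndFix [Nonempty n] (L : ℕ) (hL : 1 ≤ L) {W U : Site d → Fin d → (Matrix n n ℂ)ˣ}
    (hW : IsUnitaryCfg W) (hU : IsUnitaryCfg U) {a δ : ℝ} (ha : 0 ≤ a) (hδ : 0 ≤ δ)
    (hsmall : 512 * (d + 1) * (d + 4) * (L : ℝ) ^ 2 * a ≤ 1) (hS : SmallField W a)
    (hmis : ∀ (z : Site d) (κ : Fin d),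
      ‖((U z κ : (Matrix n n ℂ)ˣ) : Matrix n n ℂ) - ((bavg L W ((L : ℤ) • z) κ : (Matrix n n ℂ)ˣ) : Matrix n n ℂ)‖ ≤ δ)
    (hgap : 4 * (2 * (8 * (d + 1) * (d + 4) * (L : ℝ) ^ 2 * a) + 2 * δ / gap d L) ≤ gap d L)
    {P : ℕ} (hWp : IsPeriodicCfg W ((L * P : ℕ) : ℤ)) (hUp : IsPeriodicCfg U (P : ℤ)) :
    ∃ W' : Site d → Fin d → (Matrix n n ℂ)ˣ, IsUnitaryCfg W' ∧ IsPeriodicCfg W' ((L * P : ℕ) : ℤ) ∧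
      (∀ (y : Site d) (μ : Fin d),
        ‖((W' y μ : (Matrix n n ℂ)ˣ) : Matrix n n ℂ) - ((W y μ : (Matrix n n ℂ)ˣ) : Matrix n n ℂ)‖ ≤ 2 * δ / gap d L) ∧
      rescale L (bavg L W') = U := by
  letI : CStarAlgebra (Matrix n n ℂ) := {}
  obtain ⟨hcu, hcρ, hex⟩ := rescale_bavg_modify_corrField_eq hL hW hU ha hδ hsmall hS hmis hgap
  set c := corrField L W U (2 * δ / gap d L) with hcdef
  have hρ0 : 0 ≤ 2 * δ / gap d L := div_nonneg (by positivity) (gap_pos (d := d) hL).1.le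
  have hcp : IsPeriodicCfg c (P : ℤ) := by
    intro z κ μ
    refine corrField_shift (t := (P : ℤ) • e κ) _ (fun x μ' => ?_) (fun z' κ' => hUp z' κ κ') z μ
    have := hWp x κ μ'
    rw [smul_smul]
    push_cast at this
    exact this
  refine ⟨ChainEndWords.modify L W c, fun y μ => modify_mem hW hcu y μ, isPeriodicCfg_modify L hL hWp hcp,
    norm_modify_sub_le L hW hρ0 hcρ, hex⟩

end Matrices

end

end Summit.QuantumFields.BalabanUV.T4Continuum.ChainEndFixMatrix
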